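import Summits.Ventures.Crystal3D.Bulk.GapCorners
import HarnessLib

/-!
# The hole corner of a P-kite is at most `2 A_p(ρ)`: a face-shape row of the L3P kite map (K)
# as a kernel theorem for every admissible configuration

HONEST FRAMING. Part of the venture `Summits/Ventures/Crystal3D` (cell `pub-crystal3d`, phase 2;
seat p2, PROMOTION-AUDIT prep). Kernel theorems about an ADMISSIBLE fourteen-ball configuration
`c` (`IsGapConfig c`; no extremality, no convexity hypothesis) and an abstract inner-product lemma;
nothing here asserts anything about GAP(1.26), books or replays a kill, or moves a census number.
Purpose: the A lineage's third stage L3P v2.7 bounds the corners of a P-KITE `(p, a, b, c)` — the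
intruder `p` tight to the shell balls `a, c`, a shell ball `b` tight to `a` and `c` — through its
kite map (K) (`phase2/ENV-CENSUS/impla/l3p/L3P-METHOD.md` §2 (K): `cos d = cos²ρ + sin²ρ cos u_p`,
`|pb| = h_p + h_b`, constraint `|pb| ≥ ρ`), whose stated consequence is
«`u_p ≤ 2·A_p(ρ) = 160.177°` on tier I in every P-kite (equality iff `|pb| = ρ`)» (L3P-METHOD
l.21). That consequence is NOT a row of alp's pass-1 LP (which carries only the kite symmetry
`u_a = u_c`, `Bulk/GapKite.lean`), and the (K) map itself is an A-internal premise (dossier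
`A-FAMILY-AUDIT-DOSSIER-engine4-g8.md` §2.5, F-A5). THIS file proves the consequence as a ROW for
every admissible configuration, from the pair rows alone (no convexity, no face structure):

* §1 **`inner_ge_neg_cosAp_of_kite`** (any real inner product space): unit `p, a, c, b` with
  `⟪p,a⟫ = ⟪p,c⟫ = κ > 0`, `2κ² ≤ 1`, `⟪b,a⟫ = ⟪b,c⟫ = 1/2` and the pair row `⟪p,b⟫ ≤ κ` force
  `⟪a,c⟫ ≥ −(1 − 2κ²)/(2(1 − κ²)) = −cos A_p` (Cauchy–Schwarz on the components of `p` and `b`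
  orthogonal to `span{a, c}`; the near-side branch of `b` is excluded and the far-side branch gives
  the bound, in one inequality);
* §2 **`IsGapConfig.inner_gapDir_ge_of_kite`**: in an admissible configuration with `D² ≤ 2`
  (`D = intruderDist c`; the census window has `D ≤ 1.26`), the two hole contacts `a ≠ e` of a
  P-kite satisfy `⟪u_a, u_e⟫ ≥ −(2 − D²)/(4 − D²)`;
* §3 **`IsGapConfig.cos_hole_corner`** (law of cosines at the intruder:
  `cos (corner c 13 a e) = (⟪u_a, u_e⟫ − D²/4)/(1 − D²/4)`, the first line of (K)/(P)/(H)) and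
  **`IsGapConfig.hole_corner_kite_le`**: `corner c 13 a e ≤ 2 · arccos ((2 − D²)/(4 − D²)) = 2 A_p(D)`.

What stays OUTSIDE the kernel: the rest of the (K) map (`u_a = u_c = β + γ`, the corner at `b`,
`|pb| = h_p + h_b` as FUNCTIONS of `u_p` — they need the face to be convex, P-L2(a)), the (P)/(H)
fans, the grid-table cover and the interval arithmetic (dossier F-A5).
-/

noncomputable section

open scoped BigOperators InnerProductSpace
open Finset Real

namespace Summit.Ventures.Crystal3D

/-! ## §1 The abstract kite inequality -/

section Abstract

variable {F : Type*} [NormedAddCommGroup F] [InnerProductSpace ℝ F]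

/-- **Kite inequality.** In a real inner product space let `p, a, c, b` be unit vectors with
`⟪p, a⟫ = ⟪p, c⟫ = κ`, `0 < κ`, `2κ² ≤ 1`, `⟪b, a⟫ = ⟪b, c⟫ = 1/2` and `⟪p, b⟫ ≤ κ`. Then
`−(1 − 2κ²)/(2(1 − κ²)) ≤ ⟪a, c⟫`. (With `κ = cos ρ = D/2`: `⟪u_a, u_c⟫ ≥ −cos A_p(ρ)`, i.e. the
hole corner of the kite is `≤ 2 A_p(ρ)`; equality iff `⟪p, b⟫ = κ`.) Proof: for `G = ⟪a,c⟫ < 0`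
put `S = a + c`, `q = (1+G) p − κ S`, `w = 2(1+G) b − S` (the components of `p`, `b` off
`span{a,c}`, scaled): `⟪q,w⟫ = 2(1+G)((1+G)⟪p,b⟫ − κ) ≤ 2κ(1+G)G < 0`, `‖q‖² = (1+G)(1+G−2κ²)`,
`‖w‖² = 2(1+G)(1+2G)`, and Cauchy–Schwarz gives `2κ²G² ≤ (1+G−2κ²)(1+2G)`, i.e.
`0 ≤ (1 − κ²)(G + 1)(G + z)` with `z = (1−2κ²)/(2(1−κ²))`. [folklore] -/
theorem inner_ge_neg_cosAp_of_kite {p a c b : F} (hp : ‖p‖ = 1) (ha : ‖a‖ = 1) (hc : ‖c‖ = 1)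
    (hb : ‖b‖ = 1) {κ : ℝ} (hpa : ⟪p, a⟫_ℝ = κ) (hpc : ⟪p, c⟫_ℝ = κ) (hba : ⟪b, a⟫_ℝ = 1 / 2)
    (hbc : ⟪b, c⟫_ℝ = 1 / 2) (hpb : ⟪p, b⟫_ℝ ≤ κ) (hκ0 : 0 < κ) (hκ : 2 * κ ^ 2 ≤ 1) :
    -((1 - 2 * κ ^ 2) / (2 * (1 - κ ^ 2))) ≤ ⟪a, c⟫_ℝ := by
  set G := ⟪a, c⟫_ℝ with hG
  set P := ⟪p, b⟫_ℝ with hP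
  have h1κ : 0 < 1 - κ ^ 2 := by nlinarith
  have hpp : ⟪p, p⟫_ℝ = 1 := by rw [real_inner_self_eq_norm_sq, hp, one_pow]
  have haa : ⟪a, a⟫_ℝ = 1 := by rw [real_inner_self_eq_norm_sq, ha, one_pow]
  have hcc : ⟪c, c⟫_ℝ = 1 := by rw [real_inner_self_eq_norm_sq, hc, one_pow]
  have hbb : ⟪b, b⟫_ℝ = 1 := by rw [real_inner_self_eq_norm_sq, hb, one_pow]
  have hap : ⟪a, p⟫_ℝ = κ := by rw [real_inner_comm]; exact hpa
  have hcp : ⟪c, p⟫_ℝ = κ := by rw [real_inner_comm]; exact hpc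
  have hab : ⟪a, b⟫_ℝ = 1 / 2 := by rw [real_inner_comm]; exact hba
  have hcb : ⟪c, b⟫_ℝ = 1 / 2 := by rw [real_inner_comm]; exact hbc
  have hca : ⟪c, a⟫_ℝ = G := by rw [real_inner_comm]
  have hbp : ⟪b, p⟫_ℝ = P := real_inner_comm _ _
  -- `G > −1` (indeed `2 + 2G ≥ 4κ²`): Cauchy–Schwarz for `p` and `a + c`
  have hG1 : -1 < G := by
    have hcs := real_inner_mul_inner_self_le p (a + c)
    have e1 : ⟪p, a + c⟫_ℝ = 2 * κ := by rw [inner_add_right, hpa, hpc]; ring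
    have e2 : ⟪a + c, a + c⟫_ℝ = 2 + 2 * G := by
      rw [inner_add_left, inner_add_right, inner_add_right, haa, hcc, hca]; ring
    rw [e1, hpp, e2] at hcs
    nlinarith
  by_cases hG0 : 0 ≤ G
  · have hz : 0 ≤ (1 - 2 * κ ^ 2) / (2 * (1 - κ ^ 2)) := div_nonneg (by linarith) (by linarith)
    linarith
  have hG0' : G < 0 := lt_of_not_ge hG0
  -- the scaled off-plane components `q = (1+G) p − κ (a + c)`, `w = 2(1+G) b − (a + c)`
  set q := (1 + G) • p - κ • (a + c) with hq
  set w := (2 * (1 + G)) • b - (a + c) with hw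
  have hqw : ⟪q, w⟫_ℝ = 2 * (1 + G) * ((1 + G) * P - κ) := by
    simp only [hq, hw, inner_sub_left, inner_sub_right, real_inner_smul_left, real_inner_smul_right,
      inner_add_left, inner_add_right, hpa, hpc, hab, hcb, haa, hcc, hca, ← hG, ← hP]
    ring
  have hqq : ⟪q, q⟫_ℝ = (1 + G) * (1 + G - 2 * κ ^ 2) := by
    simp only [hq, inner_sub_left, inner_sub_right, real_inner_smul_left, real_inner_smul_right,
      inner_add_left, inner_add_right, hpp, hpa, hpc, hap, hcp, haa, hcc, hca, ← hG]
    ring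
  have hww : ⟪w, w⟫_ℝ = 2 * (1 + G) * (1 + 2 * G) := by
    simp only [hw, inner_sub_left, inner_sub_right, real_inner_smul_left, real_inner_smul_right,
      inner_add_left, inner_add_right, hbb, hba, hbc, hab, hcb, haa, hcc, hca, ← hG]
    ring
  have hcs := real_inner_mul_inner_self_le q w
  rw [hqw, hqq, hww] at hcs
  -- `X := ⟪q,w⟫ ≤ T := 2κ(1+G)G < 0`, hence `T² ≤ X²`
  set X := 2 * (1 + G) * ((1 + G) * P - κ) with hX
  set T := 2 * κ * (1 + G) * G with hT
  have h1G : 0 < 1 + G := by linarith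
  have hXT : X ≤ T := by
    have : (1 + G) * P ≤ (1 + G) * κ := mul_le_mul_of_nonneg_left hpb h1G.le
    rw [hX, hT]; nlinarith
  have hT0 : T < 0 := by
    rw [hT]
    have h2 : 0 < 2 * κ * (1 + G) := by positivity
    exact mul_neg_of_pos_of_neg h2 hG0'
  have hsq : T ^ 2 ≤ X ^ 2 := by
    have h := pow_le_pow_left₀ (by linarith : 0 ≤ -T) (by linarith : -T ≤ -X) 2
    simpa [neg_sq] using h
  have hXX : X ^ 2 ≤ (1 + G) * (1 + G - 2 * κ ^ 2) * (2 * (1 + G) * (1 + 2 * G)) := by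
    rw [sq]; exact hcs
  -- divide `T² ≤ ‖q‖²‖w‖²` by `2 (1+G)²`
  have key : 2 * κ ^ 2 * G ^ 2 ≤ (1 + G - 2 * κ ^ 2) * (1 + 2 * G) := by
    have h2 : 0 < 2 * (1 + G) ^ 2 := by positivity
    have h3 : 2 * (1 + G) ^ 2 * (2 * κ ^ 2 * G ^ 2) ≤
        2 * (1 + G) ^ 2 * ((1 + G - 2 * κ ^ 2) * (1 + 2 * G)) := by
      have e1 : 2 * (1 + G) ^ 2 * (2 * κ ^ 2 * G ^ 2) = T ^ 2 := by rw [hT]; ring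
      have e2 : 2 * (1 + G) ^ 2 * ((1 + G - 2 * κ ^ 2) * (1 + 2 * G)) =
          (1 + G) * (1 + G - 2 * κ ^ 2) * (2 * (1 + G) * (1 + 2 * G)) := by ring
      rw [e1, e2]; exact hsq.trans hXX
    exact le_of_mul_le_mul_left h3 h2
  -- `key ⇔ 0 ≤ (G + 1)(2(1 − κ²) G + (1 − 2κ²))`
  have hfac : 0 ≤ (1 + G) * (2 * (1 - κ ^ 2) * G + (1 - 2 * κ ^ 2)) := by
    have e : (1 + G) * (2 * (1 - κ ^ 2) * G + (1 - 2 * κ ^ 2)) =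
        (1 + G - 2 * κ ^ 2) * (1 + 2 * G) - 2 * κ ^ 2 * G ^ 2 := by ring
    rw [e]; linarith [key]
  have hlin : 0 ≤ 2 * (1 - κ ^ 2) * G + (1 - 2 * κ ^ 2) :=
    (mul_nonneg_iff_of_pos_left h1G).1 hfac
  rw [neg_le, le_div_iff₀ (by linarith)]
  linarith

end Abstract

/-! ## §2 The configuration row -/

section Config

open Literature.Geometry.DiscreteGeometry InnerProductGeometry

variable {c : Fin 14 → EuclideanSpace ℝ (Fin 3)}

/-- **The two hole contacts of a P-kite are at inner product `≥ −cos A_p(D)`.** For an admissible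
configuration with `D² ≤ 2` (`D = intruderDist c`), shell balls `a ≠ e` touching the intruder and a
shell ball `b` touching both `a` and `e`: `−(2 − D²)/(4 − D²) ≤ ⟪u_a, u_e⟫`. Only the pair rows are
used (`⟪p̂, u_b⟫ ≤ D/2`, tight pairs at their levels); no convexity. [folklore] -/
theorem IsGapConfig.inner_gapDir_ge_of_kite (hc : IsGapConfig c) (hD2 : intruderDist c ^ 2 ≤ 2)
    {a e b : Fin 14} (ha0 : a ≠ 0) (ha13 : a ≠ 13) (he0 : e ≠ 0) (he13 : e ≠ 13) (hb0 : b ≠ 0)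
    (hb13 : b ≠ 13) (ha : dist (c a) (c 13) = 1) (he : dist (c e) (c 13) = 1)
    (hba : dist (c b) (c a) = 1) (hbe : dist (c b) (c e) = 1) :
    -((2 - intruderDist c ^ 2) / (4 - intruderDist c ^ 2)) ≤ ⟪gapDir c a, gapDir c e⟫_ℝ := by
  set D := intruderDist c with hDdef
  have hD1 : 1 ≤ D := hc.one_le_intruderDist
  have h13 : (13 : Fin 14) ≠ 0 := by decide
  have hpa : ⟪gapDir c 13, gapDir c a⟫_ℝ = D / 2 := by
    rw [real_inner_comm, hc.inner_gapDir_eq ha0 h13 ha, tightLevel_of_right]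
  have hpe : ⟪gapDir c 13, gapDir c e⟫_ℝ = D / 2 := by
    rw [real_inner_comm, hc.inner_gapDir_eq he0 h13 he, tightLevel_of_right]
  have hba' : ⟪gapDir c b, gapDir c a⟫_ℝ = 1 / 2 := by
    rw [hc.inner_gapDir_eq hb0 ha0 hba, tightLevel_of_ne hb13 ha13]
  have hbe' : ⟪gapDir c b, gapDir c e⟫_ℝ = 1 / 2 := by
    rw [hc.inner_gapDir_eq hb0 he0 hbe, tightLevel_of_ne hb13 he13]
  have hpb : ⟪gapDir c 13, gapDir c b⟫_ℝ ≤ D / 2 := by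
    rw [real_inner_comm]
    have h := hc.inner_gapDir_le hb0 h13 hb13
    rw [tightLevel_of_right] at h
    exact h
  have key := inner_ge_neg_cosAp_of_kite (hc.norm_gapDir h13) (hc.norm_gapDir ha0)
    (hc.norm_gapDir he0) (hc.norm_gapDir hb0) hpa hpe hba' hbe' hpb (by linarith) (by nlinarith)
  have e : (1 - 2 * (D / 2) ^ 2) / (2 * (1 - (D / 2) ^ 2)) = (2 - D ^ 2) / (4 - D ^ 2) := by
    rw [div_eq_div_iff (by nlinarith) (by nlinarith)]; ring
  rw [e] at key
  exact key

/-- **Law of cosines at the intruder** (the first line of L3P's (K)/(P)/(H) maps,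
`cos d = cos²ρ + sin²ρ cos u_p` with `cos d = ⟪u_a, u_e⟫`, `cos ρ = D/2`): for shell balls `a, e`
touching the intruder, `cos (corner c 13 a e) = (⟪u_a, u_e⟫ − D²/4)/(1 − D²/4)`. [folklore] -/
theorem IsGapConfig.cos_hole_corner (hc : IsGapConfig c) (hD : intruderDist c < 2) {a e : Fin 14}
    (ha0 : a ≠ 0) (he0 : e ≠ 0) (ha : dist (c a) (c 13) = 1) (he : dist (c e) (c 13) = 1) :
    Real.cos (corner c 13 a e) =
      (⟪gapDir c a, gapDir c e⟫_ℝ - intruderDist c ^ 2 / 4) / (1 - intruderDist c ^ 2 / 4) := by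
  set D := intruderDist c with hDdef
  have hD1 : 1 ≤ D := hc.one_le_intruderDist
  have h13 : (13 : Fin 14) ≠ 0 := by decide
  have hpa : ⟪gapDir c 13, gapDir c a⟫_ℝ = D / 2 := by
    rw [real_inner_comm, hc.inner_gapDir_eq ha0 h13 ha, tightLevel_of_right]
  have hpe : ⟪gapDir c 13, gapDir c e⟫_ℝ = D / 2 := by
    rw [real_inner_comm, hc.inner_gapDir_eq he0 h13 he, tightLevel_of_right]
  unfold corner
  rw [InnerProductGeometry.cos_angle,
    norm_tangentProj_eq_sqrt (hc.norm_gapDir h13) (hc.norm_gapDir ha0) hpa,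
    norm_tangentProj_eq_sqrt (hc.norm_gapDir h13) (hc.norm_gapDir he0) hpe,
    inner_tangentProj_eq_twoLevel (hc.norm_gapDir h13) hpa hpe rfl,
    Real.mul_self_sqrt (by nlinarith)]
  congr 1 <;> ring

/-- `arccos (2z² − 1) = 2 arccos z` for `0 ≤ z ≤ 1` (double angle). [folklore] -/
theorem arccos_two_mul_sq_sub_one {z : ℝ} (hz0 : 0 ≤ z) (hz1 : z ≤ 1) :
    Real.arccos (2 * z ^ 2 - 1) = 2 * Real.arccos z := by
  have h0 : 0 ≤ Real.arccos z := Real.arccos_nonneg z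
  have hπ : Real.arccos z ≤ π / 2 := Real.arccos_le_pi_div_two.2 hz0
  have hcos : Real.cos (2 * Real.arccos z) = 2 * z ^ 2 - 1 := by
    rw [Real.cos_two_mul, Real.cos_arccos (by linarith) hz1]
  rw [← hcos, Real.arccos_cos (by linarith) (by linarith)]

/-- **The hole corner of a P-kite is at most `2 A_p(D)`** (L3P-METHOD §2 (K): «`u_p ≤ 2·A_p(ρ)`
… in every P-kite (equality iff `|pb| = ρ`)», here for EVERY admissible configuration with
`D² ≤ 2`, from the pair rows alone): for shell balls `a ≠ e` touching the intruder and a shell ball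
`b` touching `a` and `e`, `corner c 13 a e ≤ 2 · arccos ((2 − D²)/(4 − D²))`. [folklore] -/
theorem IsGapConfig.hole_corner_kite_le (hc : IsGapConfig c) (hD2 : intruderDist c ^ 2 ≤ 2)
    {a e b : Fin 14} (ha0 : a ≠ 0) (ha13 : a ≠ 13) (he0 : e ≠ 0) (he13 : e ≠ 13) (hb0 : b ≠ 0)
    (hb13 : b ≠ 13) (ha : dist (c a) (c 13) = 1) (he : dist (c e) (c 13) = 1)
    (hba : dist (c b) (c a) = 1) (hbe : dist (c b) (c e) = 1) :
    corner c 13 a e ≤ 2 * Real.arccos ((2 - intruderDist c ^ 2) / (4 - intruderDist c ^ 2)) := by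
  set D := intruderDist c with hDdef
  have hD1 : 1 ≤ D := hc.one_le_intruderDist
  have hD : D < 2 := by nlinarith
  have h4 : 0 < 4 - D ^ 2 := by nlinarith
  set z := (2 - D ^ 2) / (4 - D ^ 2) with hz
  have hz0 : 0 ≤ z := div_nonneg (by linarith) h4.le
  have hz1 : z ≤ 1 := by rw [div_le_one h4]; linarith
  have hG := hc.inner_gapDir_ge_of_kite hD2 ha0 ha13 he0 he13 hb0 hb13 ha he hba hbe
  have hcos := hc.cos_hole_corner hD ha0 he0 ha he
  rw [← arccos_two_mul_sq_sub_one hz0 hz1]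
  -- `corner = arccos (cos corner)` and `arccos` is antitone
  have h0 : 0 ≤ corner c 13 a e := InnerProductGeometry.angle_nonneg _ _
  have hπ : corner c 13 a e ≤ π := InnerProductGeometry.angle_le_pi _ _
  rw [← Real.arccos_cos h0 hπ]
  apply Real.arccos_le_arccos
  rw [hcos]
  -- `2z² − 1 ≤ (G − D²/4)/(1 − D²/4)` given `G ≥ −z`
  have h14 : 0 < 1 - D ^ 2 / 4 := by nlinarith
  rw [le_div_iff₀ h14]
  have hz' : z * (4 - D ^ 2) = 2 - D ^ 2 := by rw [hz, div_mul_cancel₀ _ h4.ne']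
  nlinarith [hG, hz0, hz']

end Config

end Summit.Ventures.Crystal3D
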